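import Literature.MathematicalPhysics.QuantumFieldTheory.Balaban1983to89.B8SectEKLevelFamily

/-!
# `Balaban1983to89.B8SectEKLevelFamilyLipschitz` — [Balaban1985RegularSpaces] Sect. E p. 97 AT `k` LEVELS FOR AN ABSTRACT REMAINDER FAMILY:
# «This solution is an analytic function of λ» in the form the Prop.-5 JOIN consumes — `D′` IS LIPSCHITZ IN `λ`, `‖D′(λ₁) − D′(λ₂)‖ ≤ 2·Cl·m`,
# for the remainder family `Cfam` of the sibling `B8SectEKLevelFamily` (its (1.125) row `Cl` displayed; contraction condition `Cl·B′₀ ≤ ½`)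

statement-level skeleton of published theorems with citation tags; proofs where landed; nothing here is a claim about the Yang–Mills mass gap

T. Bałaban, *Spaces of regular gauge field configurations on a lattice and gauge fixing conditions*, Commun. Math. Phys. **99** (1985)
75–102 `[Balaban1985RegularSpaces]` ("B8"; printed page = PDF page + 74), p. 97 [PDF 23].  PDF held: `paper:balaban1985-cmp99-regular-spaces-gauge-fixing`.

THE PRINTED TEXT (p. 97): «Applying it to the expression (1.122) we have |C′(λ − H′X₁) − C′(λ − H′X₂)| ≦ C′₂2B′₀(α₃ + α₄)|X₁ − X₂|, hence the
mapping (1.118) is contractive if e.g. α₃ + α₄ ≦ 1∕(4C′₂B′₀). … Thus by the contraction mapping theorem there exists exactly one solution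
of Eq. (1.117). This solution is an analytic function of λ defined on the set of λ satisfying (1.119). We take D′(λ) equal to this solution.»

WHAT IS CERTIFIED HERE (kernel; theorems only): `Dprime_diff_le_kLevel_fam` — the key inequality `‖X₁ − X₂‖ ≤ Cl·m + Cl·B′₀·‖X₁ − X₂‖` for two
solutions in the ball at `λ₁, λ₂` in the half-size set (1.119) on every tower with difference modulus `m`; `Dprime_lipschitz_kLevel_fam` —
`‖X₁ − X₂‖ ≤ 2·Cl·m` under `Cl·B′₀ ≤ ½`.  Re-abstraction of dag-n05-b's `B8SectEKLevelInLambda.Dprime_diff_le_kLevel_w` ∕ `Dprime_lipschitz_kLevel_w`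
(`Cnl L U₀ u₁ j ↦ Cfam j`, the [3] witness ∕ windows replaced by the displayed (1.125) row); proofs are that file's.  HONEST SCOPE: as the sibling —
nothing here discharges (1.125) for a concrete remainder; nothing continuum ∕ ℝ⁴ ∕ OS ∕ mass-gap ∕ Clay.  Cell `ym3-torus` seat `ym-ust-19936-w8`
(g0∕s2), 2026-08-28, `--supports stmt-QuantumFields-19200 --as helper` (★★OWNER ym3-torus-plan g26 ACK 45 (b)).
-/

noncomputable section

open NormedSpace

namespace Literature.MathematicalPhysics.QuantumFieldTheory.Balaban1983to89.B8SectEKLevelFamilyLipschitz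

open B7Prop1Explicit B7Prop1Local
open B7Eq170Flat (cj cj_apply)
open B8Ineq130 (tlo thi)
open B8Eq1122Concrete (cjDiff_sub)
open B8Eq1117Concrete (XSpace)
open B8Eq1117KLevel (dom120_of_119_tower)

-- `Site` alone could resolve to the torus sites of `Setup.lean`; re-export the `ℤ^d` sites of `B7Prop1Explicit`.
export B7Prop1Explicit (Site)

variable {d : ℕ}

/-! ## §3 `D′` is Lipschitz in `λ`, abstract remainder family -/

section Lip

variable {𝔸 : Type*} [NormedRing 𝔸] [NormedAlgebra ℂ 𝔸]
variable {L : ℕ} {U₀ : Site d → Fin d → 𝔸ˣ} {k : ℕ} {Λ : ℕ → Set (Site d)} {H' : XSpace d k 𝔸 →ₗ[ℂ] (Site d → 𝔸)}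
  {lam₁ lam₂ : Site d → 𝔸} {α₄ B₀' Cl m : ℝ} {Cfam : ℕ → (Site d → 𝔸) → Site d → 𝔸}

/-- **THE KEY INEQUALITY FOR `D′(λ₁) − D′(λ₂)` AT `k` LEVELS**, abstract remainder family: `‖X₁ − X₂‖ ≤ Cl·m + Cl·B′₀·‖X₁ − X₂‖` for `λ₁, λ₂` in
the half-size set (1.119) on every tower with difference modulus `m` there, and `X₁, X₂` in the ball solving (1.117) on `𝔅_k` for `λ₁, λ₂` and
vanishing off `𝔅_k` (the (1.125) row applied to `μᵢ = λᵢ − H′Xᵢ`, whose difference has tower modulus `m + B′₀‖X₁ − X₂‖`).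
[cite: Balaban1985RegularSpaces, p.97 (after (1.125)), (1.117)–(1.122) p.96, (1.125) p.97] -/
theorem Dprime_diff_le_kLevel_fam (hB : 0 < B₀') (hCl : 0 ≤ Cl) (hm : 0 ≤ m)
    (h₁b : ∀ j, j ≤ k → ∀ y ∈ Λ j, ∀ x : Site d, InBox (tlo L y j) (thi L y j) x → ‖lam₁ x‖ < α₄ / 2)
    (h₁a : ∀ j, j ≤ k → ∀ y ∈ Λ j, ∀ (x : Site d) (κ : Fin d), InBox (tlo L y j) (thi L y j) x →
      InBox (tlo L y j) (thi L y j) (x + e κ) → ‖cj (U₀ x κ) (lam₁ (x + e κ)) - lam₁ x‖ < α₄ / 2 * ((L : ℝ) ^ j)⁻¹)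
    (h₂b : ∀ j, j ≤ k → ∀ y ∈ Λ j, ∀ x : Site d, InBox (tlo L y j) (thi L y j) x → ‖lam₂ x‖ < α₄ / 2)
    (h₂a : ∀ j, j ≤ k → ∀ y ∈ Λ j, ∀ (x : Site d) (κ : Fin d), InBox (tlo L y j) (thi L y j) x →
      InBox (tlo L y j) (thi L y j) (x + e κ) → ‖cj (U₀ x κ) (lam₂ (x + e κ)) - lam₂ x‖ < α₄ / 2 * ((L : ℝ) ^ j)⁻¹)
    (hmb : ∀ j, j ≤ k → ∀ y ∈ Λ j, ∀ x : Site d, InBox (tlo L y j) (thi L y j) x → ‖(lam₁ - lam₂) x‖ ≤ m)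
    (hma : ∀ j, j ≤ k → ∀ y ∈ Λ j, ∀ (x : Site d) (κ : Fin d), InBox (tlo L y j) (thi L y j) x →
      InBox (tlo L y j) (thi L y j) (x + e κ) → ‖cj (U₀ x κ) ((lam₁ - lam₂) (x + e κ)) - (lam₁ - lam₂) x‖ ≤ m * ((L : ℝ) ^ j)⁻¹)
    (hH0 : ∀ (X : XSpace d k 𝔸) (x : Site d), ‖H' X x‖ ≤ B₀' * ‖X‖)
    (hH1 : ∀ j, j ≤ k → ∀ y ∈ Λ j, ∀ (X : XSpace d k 𝔸) (x : Site d) (κ : Fin d), InBox (tlo L y j) (thi L y j) x →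
      InBox (tlo L y j) (thi L y j) (x + e κ) → ‖cj (U₀ x κ) (H' X (x + e κ)) - H' X x‖ ≤ B₀' * ‖X‖ * ((L : ℝ) ^ j)⁻¹)
    (hC125 : ∀ j, j ≤ k → ∀ y ∈ Λ j, ∀ (μ₁ μ₂ : Site d → 𝔸) (m : ℝ), 0 ≤ m →
      (∀ x : Site d, InBox (tlo L y j) (thi L y j) x → ‖μ₁ x‖ < α₄) →
      (∀ (x : Site d) (κ : Fin d), InBox (tlo L y j) (thi L y j) x → InBox (tlo L y j) (thi L y j) (x + e κ) →
        ‖cj (U₀ x κ) (μ₁ (x + e κ)) - μ₁ x‖ < α₄ * ((L : ℝ) ^ j)⁻¹) →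
      (∀ x : Site d, InBox (tlo L y j) (thi L y j) x → ‖μ₂ x‖ < α₄) →
      (∀ (x : Site d) (κ : Fin d), InBox (tlo L y j) (thi L y j) x → InBox (tlo L y j) (thi L y j) (x + e κ) →
        ‖cj (U₀ x κ) (μ₂ (x + e κ)) - μ₂ x‖ < α₄ * ((L : ℝ) ^ j)⁻¹) →
      (∀ x : Site d, InBox (tlo L y j) (thi L y j) x → ‖(μ₁ - μ₂) x‖ ≤ m) →
      (∀ (x : Site d) (κ : Fin d), InBox (tlo L y j) (thi L y j) x → InBox (tlo L y j) (thi L y j) (x + e κ) →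
        ‖cj (U₀ x κ) ((μ₁ - μ₂) (x + e κ)) - (μ₁ - μ₂) x‖ ≤ m * ((L : ℝ) ^ j)⁻¹) →
      ‖Cfam j μ₁ y - Cfam j μ₂ y‖ ≤ Cl * m)
    {X₁ X₂ : XSpace d k 𝔸} (hX₁ : ‖X₁‖ ≤ α₄ / (2 * B₀')) (hX₂ : ‖X₂‖ ≤ α₄ / (2 * B₀'))
    (hzero₁ : ∀ (j : ℕ) (hj : j ≤ k) (y : Site d), y ∉ Λ j → X₁ (⟨j, Nat.lt_succ_of_le hj⟩, y) = 0)
    (hfix₁ : ∀ (j : ℕ) (hj : j ≤ k) (y : Site d), y ∈ Λ j → Cfam j (lam₁ - H' X₁) y = X₁ (⟨j, Nat.lt_succ_of_le hj⟩, y))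
    (hzero₂ : ∀ (j : ℕ) (hj : j ≤ k) (y : Site d), y ∉ Λ j → X₂ (⟨j, Nat.lt_succ_of_le hj⟩, y) = 0)
    (hfix₂ : ∀ (j : ℕ) (hj : j ≤ k) (y : Site d), y ∈ Λ j → Cfam j (lam₂ - H' X₂) y = X₂ (⟨j, Nat.lt_succ_of_le hj⟩, y)) :
    ‖X₁ - X₂‖ ≤ Cl * m + (Cl * B₀') * ‖X₁ - X₂‖ := by
  -- the modulus of `(λ₁ − H′X₁) − (λ₂ − H′X₂) = (λ₁ − λ₂) − H′(X₁ − X₂)` on the towers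
  set m' : ℝ := m + B₀' * ‖X₁ - X₂‖ with hm'
  have hm'0 : 0 ≤ m' := by positivity
  have hdiff : lam₁ - H' X₁ - (lam₂ - H' X₂) = (lam₁ - lam₂) - H' (X₁ - X₂) := by rw [map_sub]; abel
  -- the pointwise estimate on `𝔅_k`
  have hkey : ‖X₁ - X₂‖ ≤ Cl * m' := by
    refine (BoundedContinuousFunction.norm_le (by positivity)).2 fun p => ?_
    have hp : ((⟨(p.1 : ℕ), Nat.lt_succ_of_le (Nat.le_of_lt_succ p.1.isLt)⟩ : Fin (k + 1)), p.2) = p :=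
      Prod.ext (Fin.ext rfl) rfl
    have hj := Nat.le_of_lt_succ p.1.isLt
    rw [BoundedContinuousFunction.coe_sub, Pi.sub_apply]
    by_cases hy : p.2 ∈ Λ p.1
    · have e₁ := hfix₁ p.1 hj p.2 hy
      have e₂ := hfix₂ p.1 hj p.2 hy
      rw [hp] at e₁ e₂
      rw [← e₁, ← e₂]
      obtain ⟨hXa, hXb⟩ := dom120_of_119_tower H' hB (by positivity) hH0 (hH1 p.1 hj p.2 hy) (h₁a p.1 hj p.2 hy)
        (h₁b p.1 hj p.2 hy) hX₁
      obtain ⟨hYa, hYb⟩ := dom120_of_119_tower H' hB (by positivity) hH0 (hH1 p.1 hj p.2 hy) (h₂a p.1 hj p.2 hy)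
        (h₂b p.1 hj p.2 hy) hX₂
      have hmb' : ∀ x : Site d, InBox (tlo L p.2 p.1) (thi L p.2 p.1) x → ‖(lam₁ - H' X₁ - (lam₂ - H' X₂)) x‖ ≤ m' := by
        intro x hx
        rw [hdiff, Pi.sub_apply]
        calc ‖(lam₁ - lam₂) x - H' (X₁ - X₂) x‖ ≤ ‖(lam₁ - lam₂) x‖ + ‖H' (X₁ - X₂) x‖ := norm_sub_le _ _
          _ ≤ m + B₀' * ‖X₁ - X₂‖ := add_le_add (hmb p.1 hj p.2 hy x hx) (hH0 (X₁ - X₂) x)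
      have hma' : ∀ (x : Site d) (κ : Fin d), InBox (tlo L p.2 p.1) (thi L p.2 p.1) x →
          InBox (tlo L p.2 p.1) (thi L p.2 p.1) (x + e κ) →
          ‖cj (U₀ x κ) ((lam₁ - H' X₁ - (lam₂ - H' X₂)) (x + e κ)) - (lam₁ - H' X₁ - (lam₂ - H' X₂)) x‖ ≤
            m' * ((L : ℝ) ^ (p.1 : ℕ))⁻¹ := by
        intro x κ hx hxe
        rw [hdiff, cjDiff_sub]
        calc ‖cj (U₀ x κ) ((lam₁ - lam₂) (x + e κ)) - (lam₁ - lam₂) x -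
              (cj (U₀ x κ) (H' (X₁ - X₂) (x + e κ)) - H' (X₁ - X₂) x)‖
            ≤ ‖cj (U₀ x κ) ((lam₁ - lam₂) (x + e κ)) - (lam₁ - lam₂) x‖ +
                ‖cj (U₀ x κ) (H' (X₁ - X₂) (x + e κ)) - H' (X₁ - X₂) x‖ := norm_sub_le _ _
          _ ≤ m * ((L : ℝ) ^ (p.1 : ℕ))⁻¹ + B₀' * ‖X₁ - X₂‖ * ((L : ℝ) ^ (p.1 : ℕ))⁻¹ :=
              add_le_add (hma p.1 hj p.2 hy x κ hx hxe) (hH1 p.1 hj p.2 hy (X₁ - X₂) x κ hx hxe)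
          _ = m' * ((L : ℝ) ^ (p.1 : ℕ))⁻¹ := by rw [hm']; ring
      exact hC125 p.1 hj p.2 hy (lam₁ - H' X₁) (lam₂ - H' X₂) m' hm'0 hXb hXa hYb hYa hmb' hma'
    · have e₁ := hzero₁ p.1 hj p.2 hy
      have e₂ := hzero₂ p.1 hj p.2 hy
      rw [hp] at e₁ e₂
      rw [e₁, e₂, sub_self, norm_zero]
      positivity
  -- regroup
  have e1 : Cl * m' = Cl * m + (Cl * B₀') * ‖X₁ - X₂‖ := by rw [hm']; ring
  rw [← e1]; exact hkey

/-- **`D′` IS LIPSCHITZ IN `λ` AT `k` LEVELS**, abstract remainder family, under the contraction condition `Cl·B′₀ ≤ ½`: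
`‖D′(λ₁) − D′(λ₂)‖ ≤ 2·Cl·m` (p. 97, «This solution is an analytic function of λ»; here the Lipschitz sentence the Prop.-5 JOIN consumes).
[cite: Balaban1985RegularSpaces, p.97 (after (1.125)), (1.117)–(1.122) p.96] -/
theorem Dprime_lipschitz_kLevel_fam (hB : 0 < B₀') (hCl : 0 ≤ Cl) (hm : 0 ≤ m)
    (h₁b : ∀ j, j ≤ k → ∀ y ∈ Λ j, ∀ x : Site d, InBox (tlo L y j) (thi L y j) x → ‖lam₁ x‖ < α₄ / 2)
    (h₁a : ∀ j, j ≤ k → ∀ y ∈ Λ j, ∀ (x : Site d) (κ : Fin d), InBox (tlo L y j) (thi L y j) x →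
      InBox (tlo L y j) (thi L y j) (x + e κ) → ‖cj (U₀ x κ) (lam₁ (x + e κ)) - lam₁ x‖ < α₄ / 2 * ((L : ℝ) ^ j)⁻¹)
    (h₂b : ∀ j, j ≤ k → ∀ y ∈ Λ j, ∀ x : Site d, InBox (tlo L y j) (thi L y j) x → ‖lam₂ x‖ < α₄ / 2)
    (h₂a : ∀ j, j ≤ k → ∀ y ∈ Λ j, ∀ (x : Site d) (κ : Fin d), InBox (tlo L y j) (thi L y j) x →
      InBox (tlo L y j) (thi L y j) (x + e κ) → ‖cj (U₀ x κ) (lam₂ (x + e κ)) - lam₂ x‖ < α₄ / 2 * ((L : ℝ) ^ j)⁻¹)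
    (hmb : ∀ j, j ≤ k → ∀ y ∈ Λ j, ∀ x : Site d, InBox (tlo L y j) (thi L y j) x → ‖(lam₁ - lam₂) x‖ ≤ m)
    (hma : ∀ j, j ≤ k → ∀ y ∈ Λ j, ∀ (x : Site d) (κ : Fin d), InBox (tlo L y j) (thi L y j) x →
      InBox (tlo L y j) (thi L y j) (x + e κ) → ‖cj (U₀ x κ) ((lam₁ - lam₂) (x + e κ)) - (lam₁ - lam₂) x‖ ≤ m * ((L : ℝ) ^ j)⁻¹)
    (hH0 : ∀ (X : XSpace d k 𝔸) (x : Site d), ‖H' X x‖ ≤ B₀' * ‖X‖)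
    (hH1 : ∀ j, j ≤ k → ∀ y ∈ Λ j, ∀ (X : XSpace d k 𝔸) (x : Site d) (κ : Fin d), InBox (tlo L y j) (thi L y j) x →
      InBox (tlo L y j) (thi L y j) (x + e κ) → ‖cj (U₀ x κ) (H' X (x + e κ)) - H' X x‖ ≤ B₀' * ‖X‖ * ((L : ℝ) ^ j)⁻¹)
    (hC125 : ∀ j, j ≤ k → ∀ y ∈ Λ j, ∀ (μ₁ μ₂ : Site d → 𝔸) (m : ℝ), 0 ≤ m →
      (∀ x : Site d, InBox (tlo L y j) (thi L y j) x → ‖μ₁ x‖ < α₄) →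
      (∀ (x : Site d) (κ : Fin d), InBox (tlo L y j) (thi L y j) x → InBox (tlo L y j) (thi L y j) (x + e κ) →
        ‖cj (U₀ x κ) (μ₁ (x + e κ)) - μ₁ x‖ < α₄ * ((L : ℝ) ^ j)⁻¹) →
      (∀ x : Site d, InBox (tlo L y j) (thi L y j) x → ‖μ₂ x‖ < α₄) →
      (∀ (x : Site d) (κ : Fin d), InBox (tlo L y j) (thi L y j) x → InBox (tlo L y j) (thi L y j) (x + e κ) →
        ‖cj (U₀ x κ) (μ₂ (x + e κ)) - μ₂ x‖ < α₄ * ((L : ℝ) ^ j)⁻¹) →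
      (∀ x : Site d, InBox (tlo L y j) (thi L y j) x → ‖(μ₁ - μ₂) x‖ ≤ m) →
      (∀ (x : Site d) (κ : Fin d), InBox (tlo L y j) (thi L y j) x → InBox (tlo L y j) (thi L y j) (x + e κ) →
        ‖cj (U₀ x κ) ((μ₁ - μ₂) (x + e κ)) - (μ₁ - μ₂) x‖ ≤ m * ((L : ℝ) ^ j)⁻¹) →
      ‖Cfam j μ₁ y - Cfam j μ₂ y‖ ≤ Cl * m)
    (hClB : Cl * B₀' ≤ 1 / 2)
    {X₁ X₂ : XSpace d k 𝔸} (hX₁ : ‖X₁‖ ≤ α₄ / (2 * B₀')) (hX₂ : ‖X₂‖ ≤ α₄ / (2 * B₀'))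
    (hzero₁ : ∀ (j : ℕ) (hj : j ≤ k) (y : Site d), y ∉ Λ j → X₁ (⟨j, Nat.lt_succ_of_le hj⟩, y) = 0)
    (hfix₁ : ∀ (j : ℕ) (hj : j ≤ k) (y : Site d), y ∈ Λ j → Cfam j (lam₁ - H' X₁) y = X₁ (⟨j, Nat.lt_succ_of_le hj⟩, y))
    (hzero₂ : ∀ (j : ℕ) (hj : j ≤ k) (y : Site d), y ∉ Λ j → X₂ (⟨j, Nat.lt_succ_of_le hj⟩, y) = 0)
    (hfix₂ : ∀ (j : ℕ) (hj : j ≤ k) (y : Site d), y ∈ Λ j → Cfam j (lam₂ - H' X₂) y = X₂ (⟨j, Nat.lt_succ_of_le hj⟩, y)) :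
    ‖X₁ - X₂‖ ≤ 2 * Cl * m := by
  have hkey := Dprime_diff_le_kLevel_fam hB hCl hm h₁b h₁a h₂b h₂a hmb hma hH0 hH1 hC125 hX₁ hX₂ hzero₁ hfix₁ hzero₂ hfix₂
  have hXY := norm_nonneg (X₁ - X₂)
  have hk3 : (Cl * B₀') * ‖X₁ - X₂‖ ≤ 1 / 2 * ‖X₁ - X₂‖ := mul_le_mul_of_nonneg_right hClB hXY
  nlinarith [hkey, hk3, hXY, hCl, hm]

end Lip

end Literature.MathematicalPhysics.QuantumFieldTheory.Balaban1983to89.B8SectEKLevelFamilyLipschitz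

end
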